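import Summits.Ventures.HodgeRepro2.T5CyclotomicPlusGalois

/-!
# FOR EVERY ODD PRIME `ℓ`: the place of `ℚ(ζ_ℓ)⁺` above `ℓ` is totally ramified, `e(v/ℓ) = (ℓ − 1)/2`, `e(w/v) = 2`,
# `N(v) = ℓ`, unique above `ℓ`, ramified in `ℚ(ζ_ℓ)`

Tier-5 support N3 / §G-N4.2 (seat p3, gen 79). File 269 is the statement for `ℓ = 7`. Mathlib's
`IsCyclotomicExtension.Rat.ramificationIdx_eq_of_prime` / `inertiaDeg_eq_of_prime` give `e(P/ℓ) = ℓ − 1`, `f(P/ℓ) = 1`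
for the prime `P = (1 − ζ_ℓ)` of `ℚ(ζ_ℓ)` above `ℓ`; the Galois identity on `ℚ(ζ_ℓ)⁺/ℚ` (file 275) bounds
`e(v/ℓ) ≤ (ℓ − 1)/2`, so the tower law `e(v/ℓ) · e(w/v) = ℓ − 1` with `e(w/v) ∣ 2` forces `e(w/v) = 2` and
`e(v/ℓ) = (ℓ − 1)/2`; the inertia degrees are `1`, `N(v) = ℓ`, and there is one place above `ℓ` on each floor:

* `ramificationIdx_of_liesOver_self`, `inertiaDeg_of_liesOver_self` — `e(P/ℓ) = ℓ − 1`, `f(P/ℓ) = 1`;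
* `ramificationIdx_dvd_half` — `e(v/ℓ) ∣ (ℓ − 1)/2`; `ramificationIdx_over_dvd_two` — `e(w/v) ∣ 2`;
* **`ramificationIdx_over_eq_two`**, **`ramificationIdx_eq_half`** — `e(w/v) = 2`, `e(v/ℓ) = (ℓ − 1)/2`;
  `inertiaDeg_eq_one`, `inertiaDeg_over_eq_one`;
* **`absNorm_eq_self`** — `N(v) = ℓ`; **`ncard_primesOver_eq_one`**, **`ncard_primesOver_int_eq_one`**;
  `ramificationIdx'_eq_two`, **`map_le_pow_two`** — `v 𝓞_K ≤ w²`.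

§8(d): uses an L-value-free non-vanishing device: NO.
-/

open NumberField NumberField.IsCMField IsDedekindDomain IsDedekindDomain.HeightOneSpectrum Module Polynomial
open Summit.Ventures.HodgeRepro2.T5CyclotomicSevenInertPrime Summit.Ventures.HodgeRepro2.T5CyclotomicStaysPrimeIffEven
  Summit.Ventures.HodgeRepro2.T5CyclotomicHeckeCommutative Summit.Ventures.HodgeRepro2.T5CyclotomicPlusGalois
  Summit.Ventures.HodgeRepro2.T5FinitePlaceLocalDegree

namespace Summit.Ventures.HodgeRepro2.T5CyclotomicRamifiedPlace

section Ramified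

variable (ℓ : ℕ) [hℓ : Fact ℓ.Prime] (h2 : 2 < ℓ)
variable (K : Type*) [Field K] [CharZero K] [IsCyclotomicExtension {ℓ} ℚ K]

section Above

variable (P : Ideal (𝓞 K)) [P.IsPrime] [P.LiesOver (Ideal.span {(ℓ : ℤ)})]

/-- **`e(P/ℓ) = ℓ − 1`** for the prime of `ℚ(ζ_ℓ)` above `ℓ` (Mathlib). -/
theorem ramificationIdx_of_liesOver_self :
    haveI := numberFieldCyc ℓ K
    P.ramificationIdx ℤ = ℓ - 1 := by
  haveI := numberFieldCyc ℓ K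
  exact IsCyclotomicExtension.Rat.ramificationIdx_eq_of_prime ℓ K P

include ℓ in
/-- **`f(P/ℓ) = 1`** (Mathlib). -/
theorem inertiaDeg_of_liesOver_self :
    haveI := numberFieldCyc ℓ K
    P.inertiaDeg ℤ = 1 := by
  haveI := numberFieldCyc ℓ K
  exact IsCyclotomicExtension.Rat.inertiaDeg_eq_of_prime ℓ K P

end Above

section Place

variable (v : HeightOneSpectrum (𝓞 (maximalRealSubfield K))) [hv : v.asIdeal.LiesOver (Ideal.span {(ℓ : ℤ)})]
include hv

include h2 in
/-- **`e(v/ℓ) ∣ (ℓ − 1)/2`**: the Galois fundamental identity `g · e · f = (ℓ − 1)/2` on `ℚ(ζ_ℓ)⁺/ℚ`. -/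
theorem ramificationIdx_dvd_half :
    haveI := numberFieldCyc ℓ K; haveI := isCMFieldCyc ℓ h2 K
    v.asIdeal.ramificationIdx ℤ ∣ (ℓ - 1) / 2 := by
  haveI := numberFieldCyc ℓ K
  haveI := isCMFieldCyc ℓ h2 K
  haveI := isGalois_maximalRealSubfield_cyc ℓ K
  haveI : (Ideal.span {(ℓ : ℤ)}).IsPrime :=
    (Ideal.span_singleton_prime (Nat.cast_ne_zero.mpr hℓ.out.ne_zero)).mpr (Nat.prime_iff_prime_int.mp hℓ.out)
  have h := Ideal.ncard_primesOver_mul_ramificationIdxIn_mul_inertiaDegIn (Ideal.span {(ℓ : ℤ)})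
    (𝓞 (maximalRealSubfield K)) (maximalRealSubfield K ≃ₐ[ℚ] maximalRealSubfield K)
  rw [Ideal.ramificationIdxIn_eq_ramificationIdx _ v.asIdeal (maximalRealSubfield K ≃ₐ[ℚ] maximalRealSubfield K),
    IsGaloisGroup.card_eq_finrank (maximalRealSubfield K ≃ₐ[ℚ] maximalRealSubfield K) ℚ (maximalRealSubfield K),
    finrank_rat_maximalRealSubfield_cyc ℓ h2 K] at h
  exact ⟨((Ideal.span {(ℓ : ℤ)}).primesOver (𝓞 (maximalRealSubfield K))).ncard *
    (Ideal.span {(ℓ : ℤ)}).inertiaDegIn (𝓞 (maximalRealSubfield K)), by rw [← h]; ring⟩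

variable (w : HeightOneSpectrum (𝓞 K)) [hw : w.asIdeal.LiesOver v.asIdeal]
include hw

omit hv hℓ in
include h2 in
/-- **`e(w/v) ∣ 2`**: the fundamental identity on `ℚ(ζ_ℓ)/ℚ(ζ_ℓ)⁺`. -/
theorem ramificationIdx_over_dvd_two :
    haveI := numberFieldCyc ℓ K; haveI := isCMFieldCyc ℓ h2 K
    w.asIdeal.ramificationIdx (𝓞 (maximalRealSubfield K)) ∣ 2 := by
  haveI := numberFieldCyc ℓ K
  haveI := isCMFieldCyc ℓ h2 K
  have h := ncard_primesOver_mul_eq_two K v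
  rw [Ideal.ramificationIdxIn_eq_ramificationIdx v.asIdeal w.asIdeal (K ≃ₐ[maximalRealSubfield K] K)] at h
  exact ⟨(v.asIdeal.primesOver (𝓞 K)).ncard * v.asIdeal.inertiaDegIn (𝓞 K), by rw [← h]; ring⟩

/-- **The tower law `e(v/ℓ) · e(w/v) = e(w/ℓ) = ℓ − 1`.** -/
theorem ramificationIdx_mul_eq :
    haveI := numberFieldCyc ℓ K
    v.asIdeal.ramificationIdx ℤ * w.asIdeal.ramificationIdx (𝓞 (maximalRealSubfield K)) = ℓ - 1 := by
  haveI := numberFieldCyc ℓ K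
  haveI : w.asIdeal.LiesOver (Ideal.span {(ℓ : ℤ)}) := Ideal.LiesOver.trans w.asIdeal v.asIdeal _
  have htower := Ideal.ramificationIdx_tower (R := ℤ) v.asIdeal w.asIdeal
  rw [ramificationIdx_of_liesOver_self ℓ K w.asIdeal] at htower
  exact htower.symm

include h2 in
/-- **`e(w/v) = 2`: THE PLACE ABOVE `ℓ` RAMIFIES IN `ℚ(ζ_ℓ)`** — `e(v/ℓ) ≤ (ℓ − 1)/2 < ℓ − 1` rules out `e(w/v) = 1`. -/
theorem ramificationIdx_over_eq_two :
    haveI := numberFieldCyc ℓ K; haveI := isCMFieldCyc ℓ h2 K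
    w.asIdeal.ramificationIdx (𝓞 (maximalRealSubfield K)) = 2 := by
  haveI := numberFieldCyc ℓ K
  haveI := isCMFieldCyc ℓ h2 K
  have hmul := ramificationIdx_mul_eq ℓ K v w
  have hdvd := ramificationIdx_dvd_half ℓ h2 K v
  have hle : v.asIdeal.ramificationIdx ℤ ≤ (ℓ - 1) / 2 := Nat.le_of_dvd (by omega) hdvd
  rcases (Nat.dvd_prime Nat.prime_two).mp (ramificationIdx_over_dvd_two ℓ h2 K v w) with h | h
  · rw [h, mul_one] at hmul
    omega
  · exact h

include h2 in
/-- **`e(v/ℓ) = (ℓ − 1)/2`.** -/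
theorem ramificationIdx_eq_half :
    haveI := numberFieldCyc ℓ K; haveI := isCMFieldCyc ℓ h2 K
    v.asIdeal.ramificationIdx ℤ = (ℓ - 1) / 2 := by
  haveI := numberFieldCyc ℓ K
  haveI := isCMFieldCyc ℓ h2 K
  have hmul := ramificationIdx_mul_eq ℓ K v w
  rw [ramificationIdx_over_eq_two ℓ h2 K v w] at hmul
  omega

/-- **The tower law `f(v/ℓ) · f(w/v) = f(w/ℓ) = 1`.** -/
theorem inertiaDeg_mul_eq_one :
    haveI := numberFieldCyc ℓ K
    v.asIdeal.inertiaDeg ℤ * w.asIdeal.inertiaDeg (𝓞 (maximalRealSubfield K)) = 1 := by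
  haveI := numberFieldCyc ℓ K
  haveI : w.asIdeal.LiesOver (Ideal.span {(ℓ : ℤ)}) := Ideal.LiesOver.trans w.asIdeal v.asIdeal _
  have htower := Ideal.inertiaDeg_tower (R := ℤ) v.asIdeal w.asIdeal
  rw [inertiaDeg_of_liesOver_self ℓ K w.asIdeal] at htower
  exact htower.symm

/-- **`f(v/ℓ) = 1`.** -/
theorem inertiaDeg_eq_one :
    haveI := numberFieldCyc ℓ K
    v.asIdeal.inertiaDeg ℤ = 1 :=
  haveI := numberFieldCyc ℓ K
  Nat.eq_one_of_mul_eq_one_right (inertiaDeg_mul_eq_one ℓ K v w)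

/-- **`f(w/v) = 1`.** -/
theorem inertiaDeg_over_eq_one :
    haveI := numberFieldCyc ℓ K
    w.asIdeal.inertiaDeg (𝓞 (maximalRealSubfield K)) = 1 :=
  haveI := numberFieldCyc ℓ K
  Nat.eq_one_of_mul_eq_one_left (inertiaDeg_mul_eq_one ℓ K v w)

/-- **`N(v) = ℓ`.** -/
theorem absNorm_eq_self :
    haveI := numberFieldCyc ℓ K
    Ideal.absNorm v.asIdeal = ℓ := by
  haveI := numberFieldCyc ℓ K
  have h := Ideal.absNorm_pow_inertiaDeg (Ideal.span {(ℓ : ℤ)}) v.asIdeal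
  rw [absNorm_span_natCast_int, inertiaDeg_eq_one ℓ K v w, pow_one] at h
  exact h.symm

include h2 in
/-- **One place of `ℚ(ζ_ℓ)` above `v`**: `#{w ∣ v} · e(w/v) · f(w/v) = 2` with `e(w/v) = 2`, `f(w/v) = 1`. -/
theorem ncard_primesOver_eq_one :
    haveI := numberFieldCyc ℓ K; haveI := isCMFieldCyc ℓ h2 K
    (v.asIdeal.primesOver (𝓞 K)).ncard = 1 := by
  haveI := numberFieldCyc ℓ K
  haveI := isCMFieldCyc ℓ h2 K
  have h := ncard_primesOver_mul_eq_two K v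
  rw [Ideal.ramificationIdxIn_eq_ramificationIdx v.asIdeal w.asIdeal (K ≃ₐ[maximalRealSubfield K] K),
    Ideal.inertiaDegIn_eq_inertiaDeg v.asIdeal w.asIdeal (K ≃ₐ[maximalRealSubfield K] K),
    ramificationIdx_over_eq_two ℓ h2 K v w, inertiaDeg_over_eq_one ℓ K v w, mul_one] at h
  exact Nat.eq_of_mul_eq_mul_right two_pos (h.trans (one_mul 2).symm)

include h2 in
/-- **One place of `ℚ(ζ_ℓ)⁺` above `ℓ`**: the Galois identity `g · e · f = (ℓ − 1)/2` with `e(v/ℓ) = (ℓ − 1)/2`,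
`f(v/ℓ) = 1`. -/
theorem ncard_primesOver_int_eq_one :
    haveI := numberFieldCyc ℓ K; haveI := isCMFieldCyc ℓ h2 K
    ((Ideal.span {(ℓ : ℤ)}).primesOver (𝓞 (maximalRealSubfield K))).ncard = 1 := by
  haveI := numberFieldCyc ℓ K
  haveI := isCMFieldCyc ℓ h2 K
  haveI := isGalois_maximalRealSubfield_cyc ℓ K
  haveI : (Ideal.span {(ℓ : ℤ)}).IsPrime :=
    (Ideal.span_singleton_prime (Nat.cast_ne_zero.mpr hℓ.out.ne_zero)).mpr (Nat.prime_iff_prime_int.mp hℓ.out)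
  have h := Ideal.ncard_primesOver_mul_ramificationIdxIn_mul_inertiaDegIn (Ideal.span {(ℓ : ℤ)})
    (𝓞 (maximalRealSubfield K)) (maximalRealSubfield K ≃ₐ[ℚ] maximalRealSubfield K)
  rw [Ideal.inertiaDegIn_eq_inertiaDeg _ v.asIdeal (maximalRealSubfield K ≃ₐ[ℚ] maximalRealSubfield K),
    Ideal.ramificationIdxIn_eq_ramificationIdx _ v.asIdeal (maximalRealSubfield K ≃ₐ[ℚ] maximalRealSubfield K),
    IsGaloisGroup.card_eq_finrank (maximalRealSubfield K ≃ₐ[ℚ] maximalRealSubfield K) ℚ (maximalRealSubfield K),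
    finrank_rat_maximalRealSubfield_cyc ℓ h2 K, ramificationIdx_eq_half ℓ h2 K v w, inertiaDeg_eq_one ℓ K v w,
    mul_one] at h
  have hpos : 0 < (ℓ - 1) / 2 := by omega
  exact Nat.eq_of_mul_eq_mul_right hpos (h.trans (one_mul _).symm)

include h2 in
/-- **`e'(v/w) = 2`** in the `sSup` form. -/
theorem ramificationIdx'_eq_two :
    haveI := numberFieldCyc ℓ K; haveI := isCMFieldCyc ℓ h2 K
    v.asIdeal.ramificationIdx' w.asIdeal = 2 := by
  haveI := numberFieldCyc ℓ K
  haveI := isCMFieldCyc ℓ h2 K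
  rw [Ideal.ramificationIdx'_eq_ramificationIdx v.asIdeal w.asIdeal v.ne_bot]
  exact ramificationIdx_over_eq_two ℓ h2 K v w

include h2 in
/-- **`v 𝓞_K ≤ w²`**: the place above `ℓ` is ramified in `ℚ(ζ_ℓ)`. -/
theorem map_le_pow_two :
    haveI := numberFieldCyc ℓ K; haveI := isCMFieldCyc ℓ h2 K
    Ideal.map (algebraMap (𝓞 (maximalRealSubfield K)) (𝓞 K)) v.asIdeal ≤ w.asIdeal ^ 2 := by
  haveI := numberFieldCyc ℓ K
  haveI := isCMFieldCyc ℓ h2 K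
  have h := Ideal.le_pow_ramificationIdx' (p := v.asIdeal) (P := w.asIdeal)
  rwa [ramificationIdx'_eq_two ℓ h2 K v w] at h

end Place

end Ramified

end Summit.Ventures.HodgeRepro2.T5CyclotomicRamifiedPlace
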